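import Mathlib.Tactic.NormNum
import Mathlib.Tactic.Linarith
import Mathlib.Tactic.Positivity
import Summits.Ventures.CertifiedArithmetic.LowPrec.SRTreeEnvelopes
import Summits.Ventures.CertifiedArithmetic.LowPrec.SRCertificatesFP4
import Summits.Ventures.CertifiedArithmetic.LowPrec.SRCertificatesFP6FP8
import HarnessLib

/-!
# Stochastic rounding into a finite format, VI: any-order certificates (FP4 kernel witnesses; FP4/FP6/FP8 envelopes)

HONEST FRAMING: certified error envelopes and provably optimal rounding/accumulation schemes for
low-precision formats under stated cost models; every table by two implementations; no hardware or
vendor claims.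

Instances of the any-order theorems of `SRTree` / `SRTreeEnvelopes` on the OCP value sets
(`FP4.e2m1`, `Formats.e3m2/e2m3/e4m3/e5m2`, literal finsets certified equal to
`MiniFloat.valueSet` in `SRFormatsBridge`):

* **the ORDER MATTERS for the exact law, both ways** (kernel certificates, `decide +kernel`, FP4,
  four summands, pairwise tree `bal4 = ((a+b)+(c+d))` vs sequential `seq4 = (((a+b)+c)+d)`):
  `(−6, 0, 1, 1)`: pairwise exact (`Var 0`), sequential `Var 3/2`; `(−4, 3, −1, 6)`: pairwise
  `Var 3/2`, sequential exact; `(3/2, 3/2, 3/2, 3/2)`: sequential has a SATURATING branch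
  (`E ŝ = 45/8 ≠ 6`), pairwise none; `(4, −6, 4, 4)`: pairwise saturates (`E ŝ = 4 ≠ 6`), sequential
  does not;
* the pairwise worst case over all `15⁴` FP4 inputs is `Var = 2` (witness `(−6, 1, −1, 6)`, law
  `{−2 ↦ 1/4, 0 ↦ 1/2, 2 ↦ 1/4}`), STRICTLY ABOVE the sequential worst case `31/16`
  (`FP4.triple…`/table `sracc_ocp_e2m1_n4`); both maxima are read off the two-implementation tables
  `certs/sr/srtree_ocp_e2m1_{bal4,seq4}` (impl A ≡ impl B by sha256; the `seq4` table is
  byte-identical to the recursive-summation table `sracc_ocp_e2m1_n4`, as `treeExp_comb` predicts);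
* **all-tree envelopes** (no enumeration): FP4 with format-valued leaves `treeVar ≤ m`
  (`m = T.nodes` roundings), `P(|ŝ_T − ∑| ≥ t) ≤ m/t²`, surely `|ŝ_T − ∑| ≤ 2m`; for ALL leaves
  (representable or not) E3M2 `treeVar ≤ 4m`, E2M3 `≤ m/16`, E4M3 `≤ 256m`, E5M2 `≤ 2²⁴m`, each with
  its Chebyshev form — the SAME constants as the sequential envelopes of files III/`SRCertificates*`,
  now for every accumulation order.
-/

namespace Summit.Ventures.CertifiedArithmetic.LowPrec.SR

open Literature.ComputerArithmetic.ConnollyHighamMary2021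
open Finset STree

/-! ### Decidability of `LeavesIn` (kernel certificates) -/

/-- `LeavesIn` is decidable. -/
instance instDecidableLeavesIn {K : Type*} [Field K] [LinearOrder K] [IsStrictOrderedRing K]
    [DecidableEq K] (F : Finset K) : ∀ t : STree K, Decidable (LeavesIn F t)
  | .leaf x => inferInstanceAs (Decidable (x ∈ F))
  | .node l r =>
      haveI := instDecidableLeavesIn F l
      haveI := instDecidableLeavesIn F r
      inferInstanceAs (Decidable (LeavesIn F l ∧ LeavesIn F r))

namespace Trees

/-! ### Two orders of four summands -/

/-- Pairwise (balanced) summation of four summands: `((a + b) + (c + d))`, three roundings, height 2. -/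
def bal4 (a b c d : ℚ) : STree ℚ := .node (.node (.leaf a) (.leaf b)) (.node (.leaf c) (.leaf d))

/-- Sequential summation of four summands: `(((a + b) + c) + d)`, three roundings, height 3. -/
def seq4 (a b c d : ℚ) : STree ℚ := .node (.node (.node (.leaf a) (.leaf b)) (.leaf c)) (.leaf d)

/-- The pairwise tree has `3` roundings. -/
theorem bal4_nodes (a b c d : ℚ) : (bal4 a b c d).nodes = 3 := rfl
/-- The sequential tree has `3` roundings. -/
theorem seq4_nodes (a b c d : ℚ) : (seq4 a b c d).nodes = 3 := rfl
/-- The pairwise tree has height `2`. -/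
theorem bal4_height (a b c d : ℚ) : (bal4 a b c d).height = 2 := rfl
/-- The sequential tree has height `3`. -/
theorem seq4_height (a b c d : ℚ) : (seq4 a b c d).height = 3 := rfl
/-- Exact sum of the pairwise tree. -/
theorem bal4_exact (a b c d : ℚ) : (bal4 a b c d).exact = a + b + (c + d) := rfl
/-- Exact sum of the sequential tree. -/
theorem seq4_exact (a b c d : ℚ) : (seq4 a b c d).exact = a + b + c + d := rfl

/-- The sequential tree is the left comb of `SRTree` started at `a` (hence, by `treeExp_comb`, its
law is the recursive-summation law `accExp` of file II). -/
theorem seq4_eq_comb (a b c d : ℚ) : seq4 a b c d = comb (FP4.seq3 b c d) a 3 := rfl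

/-- The law of the sequential tree is the recursive-summation law `accExp` started at `a`. -/
theorem treeExp_seq4 (a b c d : ℚ) (f : ℚ → ℚ) :
    treeExp FP4.e2m1 (seq4 a b c d) f = accExp FP4.e2m1 (FP4.seq3 b c d) 3 f a := by
  rw [seq4_eq_comb, treeExp_comb]

/-! ### The order changes the exact law — both ways (FP4 kernel certificates) -/

/-- `(−6, 0, 1, 1)`: no saturation in either order; pairwise is EXACT (`Var 0`), sequential has
`Var 3/2`. -/
theorem order_witness_pairwise_better :
    NoSatT FP4.e2m1 (bal4 (-6) 0 1 1) ∧ NoSatT FP4.e2m1 (seq4 (-6) 0 1 1)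
      ∧ treeVar FP4.e2m1 (bal4 (-6) 0 1 1) = 0 ∧ treeVar FP4.e2m1 (seq4 (-6) 0 1 1) = 3 / 2 := by
  decide +kernel

/-- `(−4, 3, −1, 6)`: no saturation in either order; sequential is EXACT, pairwise has `Var 3/2`. -/
theorem order_witness_sequential_better :
    NoSatT FP4.e2m1 (bal4 (-4) 3 (-1) 6) ∧ NoSatT FP4.e2m1 (seq4 (-4) 3 (-1) 6)
      ∧ treeVar FP4.e2m1 (bal4 (-4) 3 (-1) 6) = 3 / 2 ∧ treeVar FP4.e2m1 (seq4 (-4) 3 (-1) 6) = 0 := by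
  decide +kernel

/-- **Pairwise worst case, four FP4 summands**: `(−6, 1, −1, 6)` has no saturating branch and
`Var ŝ = treeVar = 2` — the maximum over all `15⁴` inputs in the two-implementation table
`srtree_ocp_e2m1_bal4`, strictly above the sequential maximum `31/16` (`sracc_ocp_e2m1_n4`). -/
theorem pairwise_var_witness :
    NoSatT FP4.e2m1 (bal4 (-6) 1 (-1) 6) ∧ treeVar FP4.e2m1 (bal4 (-6) 1 (-1) 6) = 2 := by
  decide +kernel

/-- Its exact law: `P(ŝ = −2) = 1/4`, `P(ŝ = 0) = 1/2`, `P(ŝ = 2) = 1/4` (exact sum `0`). -/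
theorem pairwise_law_witness :
    treeExp FP4.e2m1 (bal4 (-6) 1 (-1) 6) (fun v => if v = -2 then 1 else 0) = 1 / 4
      ∧ treeExp FP4.e2m1 (bal4 (-6) 1 (-1) 6) (fun v => if v = 0 then 1 else 0) = 1 / 2
      ∧ treeExp FP4.e2m1 (bal4 (-6) 1 (-1) 6) (fun v => if v = 2 then 1 else 0) = 1 / 4 := by
  decide +kernel

/-- … and its deviation probability `P(|ŝ − 0| ≥ 2) = 1/2` (Chebyshev from `treeVar = 2` gives
`≤ 1/2`: tight here). -/
theorem pairwise_dev_prob_witness :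
    treeExp FP4.e2m1 (bal4 (-6) 1 (-1) 6) (devInd 2 0) = 1 / 2 := by
  decide +kernel

/-- The sequential worst case `(−6, 1/2, 1/2, 1)` (`Var 31/16`, table `sracc_ocp_e2m1_n4`) read as a
tree, next to its pairwise value `11/8`. -/
theorem sequential_var_witness :
    NoSatT FP4.e2m1 (seq4 (-6) (1/2) (1/2) 1) ∧ treeVar FP4.e2m1 (seq4 (-6) (1/2) (1/2) 1) = 31 / 16
      ∧ NoSatT FP4.e2m1 (bal4 (-6) (1/2) (1/2) 1) ∧ treeVar FP4.e2m1 (bal4 (-6) (1/2) (1/2) 1) = 11 / 8 := by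
  decide +kernel

/-- **Saturation depends on the order (i).** Four copies of `3/2` (exact sum `6 = max E2M1`):
sequentially the branch `3 → 9/2 ↦ 6 → 15/2` leaves the hull, so `E ŝ = 45/8 ≠ 6` (bias `−3/8`);
pairwise `3 + 3 = 6` never leaves it and the result is exact. -/
theorem saturation_order_witness_seq :
    ¬ NoSatT FP4.e2m1 (seq4 (3/2) (3/2) (3/2) (3/2)) ∧ NoSatT FP4.e2m1 (bal4 (3/2) (3/2) (3/2) (3/2))
      ∧ treeExp FP4.e2m1 (seq4 (3/2) (3/2) (3/2) (3/2)) (fun v => v) = 45 / 8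
      ∧ treeBias FP4.e2m1 (seq4 (3/2) (3/2) (3/2) (3/2)) = -3 / 8
      ∧ treeExp FP4.e2m1 (bal4 (3/2) (3/2) (3/2) (3/2)) (fun v => v) = 6 := by
  decide +kernel

/-- **Saturation depends on the order (ii).** `(4, −6, 4, 4)` (exact sum `6`): pairwise `4 + 4 = 8`
saturates (`E ŝ = 4`, bias `−2`); sequentially `−2, 2, 6` never leaves the hull (exact). -/
theorem saturation_order_witness_bal :
    ¬ NoSatT FP4.e2m1 (bal4 4 (-6) 4 4) ∧ NoSatT FP4.e2m1 (seq4 4 (-6) 4 4)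
      ∧ treeExp FP4.e2m1 (bal4 4 (-6) 4 4) (fun v => v) = 4 ∧ treeBias FP4.e2m1 (bal4 4 (-6) 4 4) = -2
      ∧ treeExp FP4.e2m1 (seq4 4 (-6) 4 4) (fun v => v) = 6 := by
  decide +kernel

/-! ### FP4: envelopes for EVERY tree with format-valued leaves (no enumeration) -/

/-- For every summation tree with E2M1 leaves: `treeVar ≤ m` (`m = T.nodes` roundings; pair table
`FP4.pair_srVar_le_one`). Equals `Var ŝ_T` when no node saturates (`treeExp_sq_sub_exact`). -/
theorem fp4_treeVar_le (t : STree ℚ) (ht : LeavesIn FP4.e2m1 t) : treeVar FP4.e2m1 t ≤ t.nodes := by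
  simpa using treeVar_le_of_mem FP4.e2m1_nonempty 1 FP4.pair_srVar_le_one t ht

/-- For every summation tree with E2M1 leaves every node's candidate gap is `≤ 2`. -/
theorem fp4_gapLET_two (t : STree ℚ) (ht : LeavesIn FP4.e2m1 t) : GapLET FP4.e2m1 2 t :=
  gapLET_of_mem FP4.e2m1_nonempty 2 FP4.pair_gap_le_two t ht

/-- **FP4 √m law in any order.** With E2M1 leaves and no saturating node,
`P(|ŝ_T − ∑ leaves| ≥ s) ≤ m / s²`. -/
theorem fp4_tree_prob_dev_ge_le (t : STree ℚ) (ht : LeavesIn FP4.e2m1 t) (h : NoSatT FP4.e2m1 t)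
    {s : ℚ} (hs : 0 < s) : treeExp FP4.e2m1 t (devInd s t.exact) ≤ t.nodes / s ^ 2 :=
  (tree_prob_dev_ge_le_treeVar FP4.e2m1 t h hs).trans
    (div_le_div_of_nonneg_right (fp4_treeVar_le t ht) (by positivity))

/-- **FP4 sure bound in any order.** With E2M1 leaves and no saturating node every outcome satisfies
`|ŝ_T − ∑ leaves| ≤ 2m`. -/
theorem fp4_tree_sure_bound (t : STree ℚ) (ht : LeavesIn FP4.e2m1 t) (h : NoSatT FP4.e2m1 t) :
    AllOut FP4.e2m1 t (fun v => |v - t.exact| ≤ t.nodes * 2) :=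
  allOut_abs_sub_le FP4.e2m1 2 t h (fp4_gapLET_two t ht)

/-- Instance: the pairwise tree of four E2M1 values has `treeVar ≤ 3` by the envelope (attained
value `2`, `pairwise_var_witness`). -/
theorem fp4_bal4_treeVar_le (a b c d : ℚ) (ha : a ∈ FP4.e2m1) (hb : b ∈ FP4.e2m1)
    (hc : c ∈ FP4.e2m1) (hd : d ∈ FP4.e2m1) : treeVar FP4.e2m1 (bal4 a b c d) ≤ 3 := by
  have := fp4_treeVar_le (bal4 a b c d) ⟨⟨ha, hb⟩, ⟨hc, hd⟩⟩
  norm_num [bal4_nodes] at this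
  exact this

/-! ### FP6 / FP8: envelopes for EVERY tree and ALL leaves (spacing form) -/

/-- **E3M2, any order**: `treeVar ≤ 4m` for every tree and all (not necessarily representable)
leaves (`G = 4`). -/
theorem e3m2_treeVar_le (t : STree ℚ) : treeVar Formats.e3m2 t ≤ t.nodes * 4 := by
  have := treeVar_le_of_succ Formats.e3m2_nonempty (G := 4) (by norm_num) Formats.e3m2_succ t
  norm_num at this ⊢; linarith

/-- E3M2 any-order √m law: no saturating node ⇒ `P(|ŝ_T − ∑| ≥ s) ≤ 4m/s²`. -/
theorem e3m2_tree_prob_dev_ge_le (t : STree ℚ) (h : NoSatT Formats.e3m2 t) {s : ℚ} (hs : 0 < s) :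
    treeExp Formats.e3m2 t (devInd s t.exact) ≤ t.nodes * 4 / s ^ 2 := by
  have := tree_prob_dev_ge_le Formats.e3m2 4 t h
    (gapLET_of_succ Formats.e3m2_nonempty (by norm_num) Formats.e3m2_succ t) hs
  refine this.trans (le_of_eq ?_)
  ring

/-- **E2M3, any order**: `treeVar ≤ m/16` (`G = 1/2`). -/
theorem e2m3_treeVar_le (t : STree ℚ) : treeVar Formats.e2m3 t ≤ t.nodes * 1 / 16 := by
  have := treeVar_le_of_succ Formats.e2m3_nonempty (G := 1/2) (by norm_num) Formats.e2m3_succ t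
  norm_num at this ⊢; linarith

/-- E2M3 any-order √m law: `P(|ŝ_T − ∑| ≥ s) ≤ m/(16 s²)`. -/
theorem e2m3_tree_prob_dev_ge_le (t : STree ℚ) (h : NoSatT Formats.e2m3 t) {s : ℚ} (hs : 0 < s) :
    treeExp Formats.e2m3 t (devInd s t.exact) ≤ t.nodes / (16 * s ^ 2) := by
  have := tree_prob_dev_ge_le Formats.e2m3 (1/2) t h
    (gapLET_of_succ Formats.e2m3_nonempty (by norm_num) Formats.e2m3_succ t) hs
  refine this.trans (le_of_eq ?_)
  field_simp
  ring

/-- **E4M3, any order**: `treeVar ≤ 256m` (`G = 32`). -/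
theorem e4m3_treeVar_le (t : STree ℚ) : treeVar Formats.e4m3 t ≤ t.nodes * 256 := by
  have := treeVar_le_of_succ Formats.e4m3_nonempty (G := 32) (by norm_num) Formats.e4m3_succ t
  norm_num at this ⊢; linarith

/-- E4M3 any-order √m law: `P(|ŝ_T − ∑| ≥ s) ≤ 256m/s²`. -/
theorem e4m3_tree_prob_dev_ge_le (t : STree ℚ) (h : NoSatT Formats.e4m3 t) {s : ℚ} (hs : 0 < s) :
    treeExp Formats.e4m3 t (devInd s t.exact) ≤ t.nodes * 256 / s ^ 2 := by
  have := tree_prob_dev_ge_le Formats.e4m3 32 t h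
    (gapLET_of_succ Formats.e4m3_nonempty (by norm_num) Formats.e4m3_succ t) hs
  refine this.trans (le_of_eq ?_)
  ring

/-- **E5M2 (finite values), any order**: `treeVar ≤ 2²⁴ m` (`G = 8192`). -/
theorem e5m2_treeVar_le (t : STree ℚ) : treeVar Formats.e5m2 t ≤ t.nodes * 16777216 := by
  have := treeVar_le_of_succ Formats.e5m2_nonempty (G := 8192) (by norm_num) Formats.e5m2_succ t
  norm_num at this ⊢; linarith

/-- E5M2 any-order √m law: `P(|ŝ_T − ∑| ≥ s) ≤ 2²⁴ m/s²`. -/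
theorem e5m2_tree_prob_dev_ge_le (t : STree ℚ) (h : NoSatT Formats.e5m2 t) {s : ℚ} (hs : 0 < s) :
    treeExp Formats.e5m2 t (devInd s t.exact) ≤ t.nodes * 16777216 / s ^ 2 := by
  have := tree_prob_dev_ge_le Formats.e5m2 8192 t h
    (gapLET_of_succ Formats.e5m2_nonempty (by norm_num) Formats.e5m2_succ t) hs
  refine this.trans (le_of_eq ?_)
  ring

end Trees

end Summit.Ventures.CertifiedArithmetic.LowPrec.SR
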